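import Literature.MathematicalPhysics.QuantumLattice.PeriodicLayeredLatticeEnergyTransport
import HarnessLib

/-!
# Layer marginals of periodic states and plane stacks with layer-dependent factors: the bookkeeping of
# INEQUIVALENT planes in a periodically stacked crystal

Topic `Literature/MathematicalPhysics/QuantumLattice` (namespace = path; family `hubbard`; general dimension
`d + 1` = stacking direction `0` + `d` in-plane directions). Sequel of `PeriodicLayeredLatticeEnergyTransport`
(stacking superlattice `stackPeriods d p`, layer cosets `layerCoset d j`, sharp class constant of an interlayer
pattern) and `InfVolFermionStateProduct` / `LayeredLatticeEnergyTransport` (product states, the uniform stack),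
written for the INEQUIVALENT-PLANE multilayer crystals of the Hubbard material programme (trilayer cuprates:
inner and outer `CuO₂` planes with different site energies, fillings and one-band parameters,
Mukuda–Shimizu–Iyo–Kitaoka 2012 §2; the one-band parameters per plane come from downfolding, Pavarini et al.
2001 eq. (1)). The equal-plane files compare a stacked crystal with ONE two-dimensional model through the cell
average; inequivalent planes need the state of EACH layer class separately and product states with
layer-DEPENDENT factors. This file is that bookkeeping; the energy transport is the sequel
`InequivalentLayerStackingTransport`.

## Contents

* §1 the cell of the stacking superlattice is the set of layer classes: `stackPeriods_zero/_succ`, the cell point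
  `layerCell d p j` of class `j : Fin (p+1)` (`cellPos_layerCell : cellPos (layerCell d p j) = layerCoset d j`),
  `layerClassOf`, the bijection `layerCellEquiv`, `sum_cell_eq_sum_layerCell`; cosets of the stacking superlattice
  only see the layer coordinate (`inCoset_stackPeriods_iff`, `inCoset_stackPeriods_add_iff`,
  `inCoset_layerCoset_layerCoset_iff`).
* §2 the null interaction `nullInteraction d` (all terms `0`; the base point of linear families of views) and its
  vanishing energies.
* §3 energies of the sublattice atoms carried by a layer class: the on-site atom of class `j` is seen only from the
  cell point of class `j` (`meanEnergy_sublatticeOnSiteViews_layerCoset`, `cellEnergy_sublatticeOnSiteViews_layerCoset`: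
  `|C|⁻¹ (ε ρ_j + U D_j)` with `ρ_j, D_j` the density / double occupancy of `ω ∘ τ_{layer j}`); an IN-PLANE hopping
  pattern of class `j` likewise (`meanEnergy_sublatticeVectorHopping_inPlane`,
  `cellEnergy_sublatticeVectorHoppingViews_layerCoset_inPlane`); interlayer patterns are bounded by the sharp class
  constant (`abs_cellEnergy_sublatticeVectorHoppingViews_layerCoset_le`: `2|t|/(p+1)`).
* §4 LAYER MARGINALS: `shift_mapAct` (pullbacks along additive maps intertwine translations),
  **`InfVolFermionState.layerMarginal ω x := (ω ∘ τ_x) ∘ Γ_{layer}`** (the state of the layer through `x`, read on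
  `ℤ^d`), its density / double occupancy / bond energies are those of `ω ∘ τ_x`
  (`density_layerMarginal`, `re_expect_docc_layerMarginal`, `meanEnergy_vectorHopping_layerMarginal`); for a state
  PERIODIC under the stacking superlattice every layer marginal is TRANSLATION INVARIANT on `ℤ^d`
  (`IsPeriodic.isTranslationInvariant_layerMarginal`, via `periodVec_stackPeriods_succ` and
  `IsPeriodic.shift_add_layerHom_unitVec`), so the one-band mean energy of a layer splits as
  `U·D + Σ_a θ_a K_a` of `ω ∘ τ_x` (`IsPeriodic.meanEnergy_vectorHoppingModel_layerMarginal`).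
* §5 PLANE STACKS: the layer class `layerClass p k` of the layer `k ∈ ℤ` (`layerClass_natCast`,
  `layerClass_add_period`); for a `ℤ`-indexed family of even factors the product over the layer tiling has no
  interlayer hopping expectation (`layerProduct_expect_creation_mul_annihilation_eq_zero`,
  `meanEnergy_layerProduct_sublatticeVectorHopping_eq_zero`), translates covariantly (`layerProduct_shift`) and has
  layer marginals the factors (`layerMarginal_layerProduct`); **`planeStack p ω h`** = the product with factor
  `ω j` in every layer of class `j`: `layerMarginal_planeStack_layerCoset` (`= ω j`),
  `density_shift_planeStack_layerCoset`, `cellEnergy_planeStack_sublatticeVectorHoppingViews_eq_zero` (interlayer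
  patterns see nothing), **`isPeriodic_planeStack`** (translation-invariant factors ⇒ periodic under the stacking
  superlattice), **`cellFilling_planeStack`** (`= (p+1)⁻¹ Σ_j ρ(ω j)`), `planeStack_mem_periodicStatesAt`.

Everything is PROVED; definitions with bodies: `layerCell`, `layerClassOf`, `layerCellEquiv`, `nullInteraction`,
`InfVolFermionState.layerMarginal`, `layerClass`, `InfVolFermionState.planeStack`; no named fact, no number, no
`sorry`. HONEST SCOPE: bookkeeping only — no Hamiltonian beyond the sublattice atoms, no energy window (sequel),
no order parameter, no `T > 0`; factors of plane stacks are even (translation-invariant states of `ℤ^d`, `d > 0`).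

## Tree / Mathlib search

REUSED: `stackPeriods`, `layerCoset`, `card_cell_stackPeriods`, `abs_cellEnergy_sublatticeVectorHoppingViews_le_div`
(`PeriodicLayeredLatticeEnergyTransport`); `layerTiling`, `layerHom(_apply/_injective/_mem_thicken/_ne_zero)`,
`tileLeg_layerTiling_add`, `cAt_eq_fermionEmbed_tileEmb_layer`, `apply_zero_ne_of_add`, `vectorHoppingModel`,
`meanEnergy_vectorHoppingModel` (`LayeredLatticeEnergyTransport`); `productState(_shift/_mapAct/_congr/
_expect_fermionEmbed_mul_fermionEmbed_of_odd)` (`InfVolFermionStateProduct`); `Cell`, `cellPos`, `periodVec`, `IsPeriodic`,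
`IsPeriodic.shift_add_periodVec`, `isTranslationInvariant_of_shift_unitVec`, `density_shiftAverage`,
`cellFilling_eq_density_cellAverage` (`PeriodicStatesCellAverage` / `SuperlatticeCellEnergyFamilies`); `InCoset`,
`inCoset_sub_zero_iff`, `sublatticeOnSite(Views)`, `meanEnergy_sublatticeOnSite`, `sublatticeVectorHopping(Views)`,
`sublatticeVectorHopping_meanEnergyObs/_apply_pair` (`SublatticeSelectiveInteractions`);
`vectorHoppingFermionInteraction_meanEnergyObs/_apply_pair`, `meanEnergy_vectorHopping_mapAct`
(`LatticeVectorHoppingInteraction`); `mapAct(_expect)`, `density_mapAct` (`InfVolFermionStateLatticeMapPullback`);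
`re_expect_docc_mapAct`, `meanEnergy_onSite_eq_one`, `IsTranslationInvariant.meanEnergy_onSite_eq_mul_docc`
(`HubbardHoppingFamilyLatticeSymmetry`); `density_nonneg/_le_two`; Mathlib `Fintype.sum_equiv`,
`Int.eq_zero_of_abs_lt_dvd`, `Int.emod_emod_of_dvd`, `Finset.sum_ite_eq'`. `lean search 'layerMarginal|planeStack|
layerCell|nullInteraction|inequivalent' --decl`: nothing.

## References

* H. Araki, H. Moriya, Rev. Math. Phys. 15 (2003) 93, §4.1 (periodic structure, cosets, translations), §11.1
  Theorem 11.2 (product states). [cite: ArakiMoriya2003, §11.1 Theorem 11.2]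
* O. Bratteli, D. W. Robinson, *OAQSM 1* (1987), §4.3.1 (group actions on states, restriction to subalgebras),
  Prop. 2.3.11. [cite: BratteliRobinsonI1987, §4.3.1]
* O. Bratteli, A. Kishimoto, D. W. Robinson, CMP 64 (1978) 41, §3 (mean energy functional). [cite: BratteliKishimotoRobinson1978, §3]
* E. Pavarini, I. Dasgupta, T. Saha-Dasgupta, O. Jepsen, O. K. Andersen, PRL 87 (2001) 047003, eq. (1)
  (one-band parameters of single- and multilayer cuprates). [cite: PavariniEtAl2001, eq. (1)]
* H. Mukuda, S. Shimizu, A. Iyo, Y. Kitaoka, J. Phys. Soc. Jpn. 81 (2012) 011008, §2 (inequivalent inner/outer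
  planes of multilayered cuprates, layer-resolved doping). [cite: MukudaEtAl2012, §2]
-/

noncomputable section

namespace Literature.MathematicalPhysics.QuantumLattice

open Matrix Finset HubbardWave0 Literature.Probability.LatticeModels ThermodynamicLimit
open scoped ComplexOrder BigOperators

variable {d : ℕ}

/-- The stacking superlattice has period `p + 1` along the layer axis. [cite: ArakiMoriya2003, §4.1] -/
theorem stackPeriods_zero (d p : ℕ) : stackPeriods d p 0 = p := if_pos rfl
/-- The stacking superlattice has period `1` in-plane. [cite: ArakiMoriya2003, §4.1] -/
theorem stackPeriods_succ (d p : ℕ) (i : Fin d) : stackPeriods d p i.succ = 0 := if_neg (Fin.succ_ne_zero i)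

/-! ### §1. The cell of the stacking superlattice = the layer classes -/

/-- **The cell point of the layer class `j`**: `(j, 0, …, 0)` as a point of the fundamental cell of
`stackPeriods d p`. [cite: ArakiMoriya2003, §4.1] -/
def layerCell (d p : ℕ) (j : Fin (p + 1)) : Cell (stackPeriods d p) :=
  fun i => ⟨if i = 0 then (j : ℕ) else 0, by
    by_cases hi : i = 0
    · subst hi; rw [if_pos rfl, stackPeriods_zero]; exact j.isLt
    · rw [if_neg hi]; exact Nat.succ_pos _⟩

/-- Layer coordinate of the cell point of class `j`. [cite: ArakiMoriya2003, §4.1] -/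
theorem layerCell_apply_zero (d p : ℕ) (j : Fin (p + 1)) : ((layerCell d p j 0 : ℕ)) = j :=
  show (if (0 : Fin (d + 1)) = 0 then (j : ℕ) else 0) = j from if_pos rfl

/-- In-plane coordinates of the cell point of class `j` vanish. [cite: ArakiMoriya2003, §4.1] -/
theorem layerCell_apply_succ (d p : ℕ) (j : Fin (p + 1)) (i : Fin d) : ((layerCell d p j i.succ : ℕ)) = 0 :=
  show (if i.succ = 0 then (j : ℕ) else 0) = 0 from if_neg (Fin.succ_ne_zero i)

/-- **The cell point of class `j` sits at the layer coset representative**: `cellPos (layerCell j) = (j, 0)`.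
[cite: ArakiMoriya2003, §4.1] -/
theorem cellPos_layerCell (d p : ℕ) (j : Fin (p + 1)) : cellPos (layerCell d p j) = layerCoset d j := by
  funext i
  refine Fin.cases ?_ (fun i => ?_) i
  · simp only [cellPos, layerCell_apply_zero, layerCoset, Fin.cons_zero]
  · simp only [cellPos, layerCell_apply_succ, layerCoset, Fin.cons_succ, Pi.zero_apply, Nat.cast_zero]

/-- **The layer class of a cell point** (its layer coordinate). [cite: ArakiMoriya2003, §4.1] -/
def layerClassOf {p : ℕ} (n : Cell (stackPeriods d p)) : Fin (p + 1) :=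
  ⟨n 0, Nat.lt_of_lt_of_eq (n 0).isLt (congrArg (· + 1) (stackPeriods_zero d p))⟩

/-- Every cell point is the cell point of its class. [cite: ArakiMoriya2003, §4.1] -/
theorem layerCell_layerClassOf {p : ℕ} (n : Cell (stackPeriods d p)) : layerCell d p (layerClassOf n) = n := by
  funext i
  apply Fin.ext
  refine Fin.cases ?_ (fun i => ?_) i
  · rw [layerCell_apply_zero]; rfl
  · rw [layerCell_apply_succ]
    have h : (n i.succ : ℕ) < 0 + 1 := Nat.lt_of_lt_of_eq (n i.succ).isLt (congrArg (· + 1) (stackPeriods_succ d p i))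
    omega

/-- The class of the cell point of class `j` is `j`. [cite: ArakiMoriya2003, §4.1] -/
theorem layerClassOf_layerCell (d p : ℕ) (j : Fin (p + 1)) : layerClassOf (layerCell d p j) = j :=
  Fin.ext (layerCell_apply_zero d p j)

/-- **Layer classes ≃ cell points** of the stacking superlattice. [cite: ArakiMoriya2003, §4.1] -/
def layerCellEquiv (d p : ℕ) : Fin (p + 1) ≃ Cell (stackPeriods d p) where
  toFun := layerCell d p
  invFun := layerClassOf
  left_inv := layerClassOf_layerCell d p
  right_inv := layerCell_layerClassOf

/-- Sums over the cell are sums over the layer classes. [cite: ArakiMoriya2003, §4.1] -/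
theorem sum_cell_eq_sum_layerCell {M : Type*} [AddCommMonoid M] (p : ℕ) (f : Cell (stackPeriods d p) → M) :
    ∑ n, f n = ∑ j : Fin (p + 1), f (layerCell d p j) :=
  (Fintype.sum_equiv (layerCellEquiv d p) _ _ fun _ => rfl).symm

/-- **Cosets of the stacking superlattice only see the layer coordinate**: `x ∈ coset(c) ↔ x₀ ≡ c₀ (mod p+1)`.
[cite: ArakiMoriya2003, §4.1] -/
theorem inCoset_stackPeriods_iff (p : ℕ) (c x : Site (d + 1)) :
    InCoset (stackPeriods d p) c x ↔ (x 0 - c 0) % ((p : ℤ) + 1) = 0 := by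
  constructor
  · intro h
    have h0 := h 0
    rwa [stackPeriods_zero] at h0
  · intro h i
    refine Fin.cases ?_ (fun i => ?_) i
    · rwa [stackPeriods_zero]
    · rw [stackPeriods_succ, Nat.cast_zero, zero_add]
      exact Int.emod_one _

/-- In-plane translations preserve the cosets of the stacking superlattice. [cite: ArakiMoriya2003, §4.1] -/
theorem inCoset_stackPeriods_add_iff (p : ℕ) (c x : Site (d + 1)) {v : Site (d + 1)} (hv : v 0 = 0) :
    InCoset (stackPeriods d p) c (x + v) ↔ InCoset (stackPeriods d p) c x := by
  rw [inCoset_stackPeriods_iff, inCoset_stackPeriods_iff, Pi.add_apply, hv, add_zero]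

/-- **Distinct layer classes are distinct cosets**: `(n,0) ∈ coset((j,0)) ↔ n = j` for classes `j, n < p + 1`.
[cite: ArakiMoriya2003, §4.1] -/
theorem inCoset_layerCoset_layerCoset_iff (p : ℕ) (j n : Fin (p + 1)) :
    InCoset (stackPeriods d p) (layerCoset d j) (layerCoset d n) ↔ n = j := by
  rw [inCoset_stackPeriods_iff]
  simp only [layerCoset, Fin.cons_zero]
  constructor
  · intro h
    have hdvd : ((p : ℤ) + 1) ∣ ((n : ℤ) - (j : ℤ)) := Int.dvd_of_emod_eq_zero h
    have habs : |((n : ℤ) - (j : ℤ))| < (p : ℤ) + 1 := by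
      rw [abs_lt]; constructor <;> omega
    have := Int.eq_zero_of_abs_lt_dvd hdvd habs
    exact Fin.ext (by omega)
  · rintro rfl
    simp

/-! ### §2. The null interaction -/

/-- **The null interaction** (every local term `0`): the base point of a linear family of views all of whose
terms are directions with couplings. [cite: BratteliKishimotoRobinson1978, §3] -/
def nullInteraction (d : ℕ) : FermionInteraction d := ⟨fun _ => 0⟩

/-- Terms of the null interaction (definitional). [cite: BratteliKishimotoRobinson1978, §3] -/
theorem nullInteraction_apply (X : Finset (Site d)) : (nullInteraction d).Φ X = 0 := rfl

/-- The null interaction is even. [cite: ArakiMoriya2003, §1 assumption (II)] -/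
theorem nullInteraction_isEven : (nullInteraction d).IsEven := fun X => by
  rw [nullInteraction_apply, map_zero]

/-- The mean-energy observable of the null interaction is `0`. [cite: BratteliKishimotoRobinson1978, §3] -/
theorem meanEnergyObs_nullInteraction (R : ℝ) : (nullInteraction d).meanEnergyObs R = 0 := by
  unfold FermionInteraction.meanEnergyObs
  exact Finset.sum_eq_zero fun X _ => by rw [nullInteraction_apply, map_zero, smul_zero]

/-- The mean energy of the null interaction vanishes in every state. [cite: BratteliKishimotoRobinson1978, §3] -/
theorem InfVolFermionState.meanEnergy_nullInteraction (ω : InfVolFermionState d) (R : ℝ) :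
    ω.meanEnergy (nullInteraction d) R = 0 := by
  rw [InfVolFermionState.meanEnergy, meanEnergyObs_nullInteraction, map_zero, Complex.zero_re]

/-- The cell energy of the constant null views vanishes in every state. [cite: BratteliKishimotoRobinson1978, §3] -/
theorem InfVolFermionState.cellEnergy_nullViews {q : Fin d → ℕ} (ω : InfVolFermionState d) (R : ℝ) :
    ω.cellEnergy (fun _ : Cell q => nullInteraction d) R = 0 := by
  simp only [InfVolFermionState.cellEnergy, InfVolFermionState.meanEnergy_nullInteraction, Finset.sum_const_zero,
    mul_zero]

/-! ### §3. Energies of the sublattice atoms at layer cosets -/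

section Atoms

variable (p : ℕ)

/-- **The on-site atom of layer class `j` is seen only from the cell point of class `j`**: its view from class `n`
has mean energy `[n = j]·(ε ρ(ω) + U D(ω))`. [cite: BratteliKishimotoRobinson1978, §3 (mean energy functional)] -/
theorem InfVolFermionState.meanEnergy_sublatticeOnSiteViews_layerCoset (ω : InfVolFermionState (d + 1))
    (j n : Fin (p + 1)) (ε U R : ℝ) :
    ω.meanEnergy (sublatticeOnSiteViews (stackPeriods d p) (layerCoset d j) ε U (layerCell d p n)) R =
      if n = j then
        ε * ω.density + U * (ω.expect {0} (nAt (0 : Site (d + 1)) (mem_singleton_self 0) 0 * nAt 0 (mem_singleton_self 0) 1)).re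
      else 0 := by
  rw [sublatticeOnSiteViews, InfVolFermionState.meanEnergy_sublatticeOnSite]
  have hiff : InCoset (stackPeriods d p) (layerCoset d j - cellPos (layerCell d p n)) 0 ↔ n = j := by
    rw [inCoset_sub_zero_iff, cellPos_layerCell, inCoset_layerCoset_layerCoset_iff]
  by_cases h : n = j
  · rw [if_pos (hiff.2 h), if_pos h]
  · rw [if_neg (fun h' => h (hiff.1 h')), if_neg h]

/-- **Cell energy of the on-site atom of layer class `j`**: `(p+1)⁻¹ (ε ρ_j + U D_j)` with `ρ_j`, `D_j` the density
and double occupancy of `ω ∘ τ_{(j,0)}`. [cite: BratteliKishimotoRobinson1978, §3 (mean energy functional)] -/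
theorem InfVolFermionState.cellEnergy_sublatticeOnSiteViews_layerCoset (ω : InfVolFermionState (d + 1))
    (j : Fin (p + 1)) (ε U R : ℝ) :
    ω.cellEnergy (sublatticeOnSiteViews (stackPeriods d p) (layerCoset d j) ε U) R =
      ((p : ℝ) + 1)⁻¹ *
        (ε * (ω.shift (layerCoset d j)).density +
          U * ((ω.shift (layerCoset d j)).expect {0}
            (nAt (0 : Site (d + 1)) (mem_singleton_self 0) 0 * nAt 0 (mem_singleton_self 0) 1)).re) := by
  rw [InfVolFermionState.cellEnergy, card_cell_stackPeriods, Nat.cast_add, Nat.cast_one, sum_cell_eq_sum_layerCell]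
  simp only [InfVolFermionState.meanEnergy_sublatticeOnSiteViews_layerCoset, cellPos_layerCell, Finset.sum_ite_eq',
    Finset.mem_univ, if_true]

/-- **An in-plane hopping pattern carried by a coset is the full bond energy or nothing**: for `v₀ = 0`,
`e_{Φ_{c,v}}(ω) = [0 ∈ coset(c)]·K_v(ω)` (both bonds through the origin start in the coset of the origin).
[cite: BratteliKishimotoRobinson1978, §3 (mean energy functional)] -/
theorem InfVolFermionState.meanEnergy_sublatticeVectorHopping_inPlane (ω : InfVolFermionState (d + 1))
    (c : Site (d + 1)) {v : Site (d + 1)} (hv : v ≠ 0) (hv0 : v 0 = 0) (t : ℝ) {R : ℝ}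
    (hvR : v ∈ thicken ({0} : Finset (Site (d + 1))) R) :
    ω.meanEnergy (sublatticeVectorHopping (stackPeriods d p) c v t) R =
      if InCoset (stackPeriods d p) c 0 then ω.meanEnergy (vectorHoppingFermionInteraction (d + 1) v t) R else 0 := by
  have hneg : InCoset (stackPeriods d p) c (-v) ↔ InCoset (stackPeriods d p) c 0 := by
    have h := inCoset_stackPeriods_add_iff p c (-v) hv0
    rw [neg_add_cancel] at h
    exact h.symm
  unfold InfVolFermionState.meanEnergy
  rw [sublatticeVectorHopping_meanEnergyObs _ c hv t hvR, vectorHoppingFermionInteraction_meanEnergyObs hv t hvR,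
    sublatticeVectorHopping_apply_pair _ c hv t 0, sublatticeVectorHopping_apply_pair _ c hv t (-v)]
  by_cases h0 : InCoset (stackPeriods d p) c 0
  · rw [if_pos h0, if_pos (hneg.2 h0), if_pos h0]
  · rw [if_neg h0, if_neg (fun h => h0 (hneg.1 h)), if_neg h0, map_zero, map_zero, smul_zero, add_zero,
      map_zero, Complex.zero_re]

/-- **Cell energy of an in-plane hopping pattern of layer class `j`**: `(p+1)⁻¹ K_v(ω ∘ τ_{(j,0)})`.
[cite: BratteliKishimotoRobinson1978, §3 (mean energy functional)] -/
theorem InfVolFermionState.cellEnergy_sublatticeVectorHoppingViews_layerCoset_inPlane (ω : InfVolFermionState (d + 1))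
    (j : Fin (p + 1)) {v : Site (d + 1)} (hv : v ≠ 0) (hv0 : v 0 = 0) (t : ℝ) {R : ℝ}
    (hvR : v ∈ thicken ({0} : Finset (Site (d + 1))) R) :
    ω.cellEnergy (sublatticeVectorHoppingViews (stackPeriods d p) (layerCoset d j) v t) R =
      ((p : ℝ) + 1)⁻¹ * (ω.shift (layerCoset d j)).meanEnergy (vectorHoppingFermionInteraction (d + 1) v t) R := by
  rw [InfVolFermionState.cellEnergy, card_cell_stackPeriods, Nat.cast_add, Nat.cast_one, sum_cell_eq_sum_layerCell]
  simp only [sublatticeVectorHoppingViews, cellPos_layerCell,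
    InfVolFermionState.meanEnergy_sublatticeVectorHopping_inPlane p _ _ hv hv0 t hvR, inCoset_sub_zero_iff,
    inCoset_layerCoset_layerCoset_iff, Finset.sum_ite_eq', Finset.mem_univ, if_true]

/-- **Interlayer patterns of a layer class cost at most `2|t|/(p+1)`** (sharp class constant of the parent file).
[cite: BratteliRobinsonI1987, Prop. 2.3.11] -/
theorem InfVolFermionState.abs_cellEnergy_sublatticeVectorHoppingViews_layerCoset_le (ω : InfVolFermionState (d + 1))
    (j : Fin (p + 1)) {w : Site (d + 1)} (hw : w ≠ 0) (t : ℝ) {R : ℝ}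
    (hwR : w ∈ thicken ({0} : Finset (Site (d + 1))) R) :
    |ω.cellEnergy (sublatticeVectorHoppingViews (stackPeriods d p) (layerCoset d j) w t) R| ≤ 2 / ((p : ℝ) + 1) * |t| := by
  have h := abs_cellEnergy_sublatticeVectorHoppingViews_le_div (stackPeriods d p) (layerCoset d j) hw t hwR ω
  rw [card_cell_stackPeriods, Nat.cast_add, Nat.cast_one] at h
  rw [div_mul_eq_mul_div]
  exact h

end Atoms

/-! ### §4. Layer marginals of periodic states -/

namespace InfVolFermionState

variable {d' : ℕ}

/-- **Pullbacks along additive maps intertwine translations**: `(ω ∘ Γ_f) ∘ τ_v = (ω ∘ τ_{f v}) ∘ Γ_f`.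
[cite: BratteliRobinsonI1987, §4.3.1] -/
theorem shift_mapAct (ω : InfVolFermionState d') (f : Site d →+ Site d') (hf : Function.Injective f) (v : Site d) :
    (ω.mapAct f hf).shift v = (ω.shift (f v)).mapAct f hf := by
  refine InfVolFermionState.ext fun Λ => LinearMap.ext fun A => ?_
  rw [shift_expect, mapAct_expect, mapAct_expect, shift_expect, fermionEmbed_fermionEmbed, fermionEmbed_fermionEmbed]
  have hsub : mapSet f (shiftSet v Λ) ⊆ shiftSet (f v) (mapSet f Λ) := by
    intro y hy
    obtain ⟨x, hx, rfl⟩ := (mem_mapSet_iff f).1 hy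
    have hx' : x - v ∈ Λ := mem_shiftSet.1 hx
    exact mem_shiftSet.2 ((mem_mapSet_iff f).2 ⟨x - v, hx', map_sub f x v⟩)
  rw [← ω.compatible hsub, fermionEmbed_fermionEmbed,
    fermionEmbed_congr
      (φ := ((PolySite.shiftEmb v Λ).trans (PolySite.mapEmb f hf (shiftSet v Λ))).trans (PolySite.incl hsub))
      (ψ := (PolySite.mapEmb f hf Λ).trans (PolySite.shiftEmb (f v) (mapSet f Λ)))
      (fun y => Subtype.ext (by
        simp only [Function.Embedding.trans_apply, PolySite.coe_incl, PolySite.coe_mapEmb_eq,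
          PolySite.coe_shiftEmb, ofLex_toLex, map_add]))]

/-- **The layer marginal through `x`**: the state `ω ∘ τ_x` read on the layer through the origin, as a state
of the lattice fermions on `ℤ^d` (restriction to the subalgebra of one layer, re-centred at `x`).
[cite: BratteliRobinsonI1987, §4.3.1] -/
def layerMarginal (ω : InfVolFermionState (d + 1)) (x : Site (d + 1)) : InfVolFermionState d :=
  (ω.shift x).mapAct (layerHom d) (layerHom_injective d)

/-- The layer marginal through `x` has the density of `ω` at `x`. [cite: ArakiMoriya2003, §4.1] -/
theorem density_layerMarginal (ω : InfVolFermionState (d + 1)) (x : Site (d + 1)) :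
    (ω.layerMarginal x).density = (ω.shift x).density :=
  density_mapAct _ _ _ (map_zero _)

/-- The layer marginal through `x` has the double occupancy of `ω` at `x`. [cite: ArakiMoriya2003, §4.1] -/
theorem re_expect_docc_layerMarginal (ω : InfVolFermionState (d + 1)) (x : Site (d + 1)) :
    ((ω.layerMarginal x).expect {0} (nAt (0 : Site d) (mem_singleton_self 0) 0 * nAt 0 (mem_singleton_self 0) 1)).re =
      ((ω.shift x).expect {0} (nAt (0 : Site (d + 1)) (mem_singleton_self 0) 0 * nAt 0 (mem_singleton_self 0) 1)).re :=
  re_expect_docc_mapAct _ _ _ (map_zero _)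

/-- **In-plane bond energies of the layer marginal are the lifted bond energies of `ω ∘ τ_x`**: `K_u = K_{(0,u)}`.
[cite: BratteliRobinsonI1987, §4.3.1] -/
theorem meanEnergy_vectorHopping_layerMarginal (ω : InfVolFermionState (d + 1)) (x : Site (d + 1)) {u : Site d}
    (hu : u ≠ 0) (t : ℝ) {R R' : ℝ} (huR : u ∈ thicken ({0} : Finset (Site d)) R)
    (huR' : layerHom d u ∈ thicken ({0} : Finset (Site (d + 1))) R') :
    (ω.layerMarginal x).meanEnergy (vectorHoppingFermionInteraction d u t) R =
      (ω.shift x).meanEnergy (vectorHoppingFermionInteraction (d + 1) (layerHom d u) t) R' :=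
  (ω.shift x).meanEnergy_vectorHopping_mapAct (layerHom d) (layerHom_injective d) hu t huR huR'

/-- The in-plane periods of the stacking superlattice are the lifted unit vectors. [cite: ArakiMoriya2003, §4.1] -/
theorem periodVec_stackPeriods_succ (p : ℕ) (i : Fin d) :
    periodVec (stackPeriods d p) i.succ = layerHom d (unitVec i) := by
  funext k
  rw [periodVec, stackPeriods_succ, Nat.cast_zero, zero_add, layerHom_apply]
  refine Fin.cases ?_ (fun k => ?_) k
  · rw [Fin.cons_zero, Pi.single_eq_of_ne (Fin.succ_ne_zero i).symm]
  · rw [Fin.cons_succ, unitVec]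
    by_cases hk : k = i
    · subst hk; rw [Pi.single_eq_same, Pi.single_eq_same]
    · rw [Pi.single_eq_of_ne hk, Pi.single_eq_of_ne (fun h => hk (Fin.succ_injective _ h))]

/-- A state periodic under the stacking superlattice is invariant under in-plane unit translations.
[cite: ArakiMoriya2003, §4.1 Def. 4.5] -/
theorem IsPeriodic.shift_add_layerHom_unitVec {p : ℕ} {ω : InfVolFermionState (d + 1)}
    (hω : ω.IsPeriodic (stackPeriods d p)) (x : Site (d + 1)) (i : Fin d) :
    ω.shift (x + layerHom d (unitVec i)) = ω.shift x := by
  rw [← periodVec_stackPeriods_succ, hω.shift_add_periodVec]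

/-- **Every layer marginal of a state periodic under the stacking superlattice is translation invariant on `ℤ^d`.**
[cite: ArakiMoriya2003, §4.1 Def. 4.5] -/
theorem IsPeriodic.isTranslationInvariant_layerMarginal {p : ℕ} {ω : InfVolFermionState (d + 1)}
    (hω : ω.IsPeriodic (stackPeriods d p)) (x : Site (d + 1)) : (ω.layerMarginal x).IsTranslationInvariant := by
  refine isTranslationInvariant_of_shift_unitVec fun i => ?_
  rw [layerMarginal, shift_mapAct, shift_shift, add_comm (layerHom d (unitVec i)) x, hω.shift_add_layerHom_unitVec]

/-- **The one-band mean energy of a layer**: for `ω` periodic under the stacking superlattice,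
`e_{Φ^{0,U} + Σθ_aΦ_{u_a}}(layer marginal at x) = U·D(ω ∘ τ_x) + Σ_a θ_a K_{(0,u_a)}(ω ∘ τ_x)`.
[cite: BratteliKishimotoRobinson1978, §3 (mean energy functional)] -/
theorem IsPeriodic.meanEnergy_vectorHoppingModel_layerMarginal {ι : Type*} [Fintype ι] {p : ℕ}
    {ω : InfVolFermionState (d + 1)} (hω : ω.IsPeriodic (stackPeriods d p)) (x : Site (d + 1)) (U : ℝ)
    {u : ι → Site d} (hu : ∀ a, u a ≠ 0) (θ : ι → ℝ) {R R' : ℝ} (hR : 1 ≤ R) (hRR' : R ≤ R')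
    (huR : ∀ a, u a ∈ thicken ({0} : Finset (Site d)) R) :
    (ω.layerMarginal x).meanEnergy (vectorHoppingModel U u θ) R =
      U * ((ω.shift x).expect {0} (nAt (0 : Site (d + 1)) (mem_singleton_self 0) 0 * nAt 0 (mem_singleton_self 0) 1)).re +
        ∑ a, θ a * (ω.shift x).meanEnergy (vectorHoppingFermionInteraction (d + 1) (layerHom d (u a)) 1) R' := by
  rw [meanEnergy_vectorHoppingModel, (ω.layerMarginal x).meanEnergy_onSite_eq_one U hR,
    (hω.isTranslationInvariant_layerMarginal x).meanEnergy_onSite_eq_mul_docc U, re_expect_docc_layerMarginal]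
  congr 1
  refine Finset.sum_congr rfl fun a _ => ?_
  rw [ω.meanEnergy_vectorHopping_layerMarginal x (hu a) 1 (huR a) (thicken_mono _ hRR' (layerHom_mem_thicken (huR a)))]

/-- Densities of translates are non-negative. [cite: ArakiMoriya2003, §4.1] -/
theorem density_shift_nonneg (ω : InfVolFermionState d) (x : Site d) : 0 ≤ (ω.shift x).density := density_nonneg _
/-- Densities of translates are at most `2`. [cite: ArakiMoriya2003, §4.1] -/
theorem density_shift_le_two (ω : InfVolFermionState d) (x : Site d) : (ω.shift x).density ≤ 2 := density_le_two _

end InfVolFermionState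

/-! ### §5. Plane stacks: periodic product states with layer-dependent factors -/

section LayerClass

/-- **The layer class of the layer `k ∈ ℤ`**: `k mod (p+1)` as an element of `Fin (p+1)`. [cite: ArakiMoriya2003, §4.1] -/
def layerClass (p : ℕ) (k : ℤ) : Fin (p + 1) :=
  ⟨(k % ((p : ℤ) + 1)).toNat, by
    have h0 : (0 : ℤ) < (p : ℤ) + 1 := by positivity
    have h1 := Int.emod_nonneg k h0.ne'
    have h2 := Int.emod_lt_of_pos k h0
    omega⟩

/-- The class of layer `k` represents `k mod (p+1)`. [cite: ArakiMoriya2003, §4.1] -/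
theorem layerClass_coe (p : ℕ) (k : ℤ) : ((layerClass p k : ℕ) : ℤ) = k % ((p : ℤ) + 1) := by
  have h0 : (0 : ℤ) < (p : ℤ) + 1 := by positivity
  rw [layerClass, Int.toNat_of_nonneg (Int.emod_nonneg k h0.ne')]

/-- The class of the layer `j < p + 1` is `j`. [cite: ArakiMoriya2003, §4.1] -/
theorem layerClass_natCast (p : ℕ) (j : Fin (p + 1)) : layerClass p (j : ℕ) = j := by
  apply Fin.ext
  have h := layerClass_coe p (j : ℕ)
  have hj : ((j : ℕ) : ℤ) % ((p : ℤ) + 1) = (j : ℕ) := Int.emod_eq_of_lt (by positivity) (by have := j.isLt; omega)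
  rw [hj] at h
  exact_mod_cast h

/-- Layer classes are periodic with period `p + 1`. [cite: ArakiMoriya2003, §4.1] -/
theorem layerClass_add_period (p : ℕ) (k : ℤ) : layerClass p (k + ((p : ℤ) + 1)) = layerClass p k := by
  apply Fin.ext
  have h1 := layerClass_coe p (k + ((p : ℤ) + 1))
  have h2 := layerClass_coe p k
  rw [Int.add_emod_right] at h1
  exact_mod_cast h1.trans h2.symm

end LayerClass

namespace InfVolFermionState

/-- **A hopping word between different layers has zero expectation in every product over the layer tiling** (odd ⊗ odd,
even factors). [cite: ArakiMoriya2003, §4.1 eq. (4.8) and §11.1 Theorem 11.2] -/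
theorem layerProduct_expect_creation_mul_annihilation_eq_zero (ω : ℤ → InfVolFermionState d)
    (h : ∀ k, (ω k).IsEven) {Λ : Finset (Site (d + 1))} {x x' : Site (d + 1)} (hx : x ∈ Λ) (hx' : x' ∈ Λ)
    (hxx' : x 0 ≠ x' 0) (σ τ : Fin 2) :
    (productState (layerTiling d) ω h).expect Λ ((cAt x hx σ)ᴴ * cAt x' hx' τ) = 0 := by
  rw [cAt_eq_fermionEmbed_tileEmb_layer x hx σ, cAt_eq_fermionEmbed_tileEmb_layer x' hx' τ, ← fermionEmbed_conjTranspose,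
    productState_expect_fermionEmbed_mul_fermionEmbed_of_odd (layerTiling d) _ _ Λ hxx']
  rw [cAt, annihilation_conjTranspose, parityAut_creation]

/-- **Sublattice-selective interlayer bonds have zero mean energy in every product over the layer tiling.**
[cite: ArakiMoriya2003, §11.1 Theorem 11.2] -/
theorem meanEnergy_layerProduct_sublatticeVectorHopping_eq_zero (ω : ℤ → InfVolFermionState d)
    (h : ∀ k, (ω k).IsEven) (q : Fin (d + 1) → ℕ) (c : Site (d + 1)) {w : Site (d + 1)} (hw : w 0 ≠ 0) (t : ℝ)
    {R : ℝ} (hwR : w ∈ thicken ({0} : Finset (Site (d + 1))) R) :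
    (productState (layerTiling d) ω h).meanEnergy (sublatticeVectorHopping q c w t) R = 0 := by
  have hw0 : w ≠ 0 := fun h0 => hw (by rw [h0]; rfl)
  have hpair : ∀ x : Site (d + 1),
      (productState (layerTiling d) ω h).expect {x, x + w} ((sublatticeVectorHopping q c w t).Φ {x, x + w}) = 0 := by
    intro x
    rw [sublatticeVectorHopping_apply_pair q c hw0 t x]
    split_ifs
    · rw [vectorHoppingFermionInteraction_apply_pair hw0, map_smul, map_sum]
      refine smul_eq_zero_of_right _ (Finset.sum_eq_zero fun σ _ => ?_)
      rw [map_add, layerProduct_expect_creation_mul_annihilation_eq_zero ω h _ _ (apply_zero_ne_of_add hw),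
        layerProduct_expect_creation_mul_annihilation_eq_zero ω h _ _ (apply_zero_ne_of_add hw).symm, add_zero]
    · exact map_zero _
  rw [InfVolFermionState.meanEnergy, sublatticeVectorHopping_meanEnergyObs q c hw0 t hwR, map_add, map_smul, map_smul,
    (productState (layerTiling d) ω h).compatible, (productState (layerTiling d) ω h).compatible, hpair]
  have h2 := hpair (-w)
  rw [show -w + w = (0 : Site (d + 1)) from neg_add_cancel w] at h2 ⊢
  rw [h2, smul_zero, add_zero, Complex.zero_re]

/-- **Translating a product over the layer tiling relabels the layers and translates the factors in-plane**:
`(⊗_k ω_k) ∘ τ_v = ⊗_k (ω_{k+v₀} ∘ τ_{tail v})`. [cite: ArakiMoriya2003, §4.1 Def. 4.5] -/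
theorem layerProduct_shift (ω : ℤ → InfVolFermionState d) (h : ∀ k, (ω k).IsEven) (v : Site (d + 1)) :
    (productState (layerTiling d) ω h).shift v =
      productState (layerTiling d) (fun k => (ω (k + v 0)).shift (Fin.tail v)) fun k => (h (k + v 0)).shift (Fin.tail v) :=
  productState_shift (layerTiling d) ω h v (fun k => k + v 0) (fun _ _ hkj => add_right_cancel hkj) (fun _ => Fin.tail v)
    fun k y => tileLeg_layerTiling_add v k y

/-- **The layer marginal of a product over the layer tiling through `x` is the factor of the layer of `x`, translated
in-plane by the in-plane part of `x`.** [cite: ArakiMoriya2003, §11.1 Theorem 11.2] -/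
theorem layerMarginal_layerProduct (ω : ℤ → InfVolFermionState d) (h : ∀ k, (ω k).IsEven) (x : Site (d + 1)) :
    (productState (layerTiling d) ω h).layerMarginal x = (ω (x 0)).shift (Fin.tail x) := by
  rw [layerMarginal, layerProduct_shift]
  have hm := productState_mapAct (layerTiling d) (fun k => (ω (k + x 0)).shift (Fin.tail x))
    (fun k => (h (k + x 0)).shift (Fin.tail x)) 0
  rw [zero_add] at hm
  exact hm

variable (p : ℕ)

/-- **The plane stack** of a family of even states `ω j` of `ℤ^d` indexed by the layer classes: Araki–Moriya's
product state over the layer tiling with the factor `ω (k mod p+1)` in layer `k` (inequivalent planes: every class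
its own state). [cite: ArakiMoriya2003, §11.1 Theorem 11.2] -/
def planeStack (ω : Fin (p + 1) → InfVolFermionState d) (h : ∀ j, (ω j).IsEven) : InfVolFermionState (d + 1) :=
  productState (layerTiling d) (fun k => ω (layerClass p k)) fun k => h (layerClass p k)

variable {p}

/-- Layer coordinate of the coset representative. [cite: ArakiMoriya2003, §4.1] -/
theorem layerCoset_apply_zero (j : Fin (p + 1)) : layerCoset d (j : ℤ) 0 = (j : ℕ) := by
  rw [layerCoset, Fin.cons_zero]

/-- In-plane coordinates of the coset representative vanish. [cite: ArakiMoriya2003, §4.1] -/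
theorem tail_layerCoset (j : ℤ) : Fin.tail (layerCoset d j) = 0 := by
  funext i
  rw [Fin.tail, layerCoset, Fin.cons_succ, Pi.zero_apply]

/-- **The layer marginal of the plane stack through the layer of class `j` is `ω j`.**
[cite: ArakiMoriya2003, §11.1 Theorem 11.2] -/
theorem layerMarginal_planeStack_layerCoset (ω : Fin (p + 1) → InfVolFermionState d) (h : ∀ j, (ω j).IsEven)
    (j : Fin (p + 1)) : (planeStack p ω h).layerMarginal (layerCoset d j) = ω j := by
  rw [planeStack, layerMarginal_layerProduct, tail_layerCoset, shift_zero, layerCoset_apply_zero, layerClass_natCast]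

/-- Densities of the plane stack, class by class: `ρ((⊗ω) ∘ τ_{(j,0)}) = ρ(ω j)`. [cite: ArakiMoriya2003, §11.1 Theorem 11.2] -/
theorem density_shift_planeStack_layerCoset (ω : Fin (p + 1) → InfVolFermionState d) (h : ∀ j, (ω j).IsEven)
    (j : Fin (p + 1)) : ((planeStack p ω h).shift (layerCoset d j)).density = (ω j).density := by
  rw [← density_layerMarginal, layerMarginal_planeStack_layerCoset]

/-- Interlayer patterns have zero mean energy in every translate of the plane stack. [cite: ArakiMoriya2003, §11.1 Theorem 11.2] -/
theorem meanEnergy_shift_planeStack_sublatticeVectorHopping_eq_zero (ω : Fin (p + 1) → InfVolFermionState d)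
    (h : ∀ j, (ω j).IsEven) (x : Site (d + 1)) (q : Fin (d + 1) → ℕ) (c : Site (d + 1)) {w : Site (d + 1)}
    (hw : w 0 ≠ 0) (t : ℝ) {R : ℝ} (hwR : w ∈ thicken ({0} : Finset (Site (d + 1))) R) :
    ((planeStack p ω h).shift x).meanEnergy (sublatticeVectorHopping q c w t) R = 0 := by
  rw [planeStack, layerProduct_shift]
  exact meanEnergy_layerProduct_sublatticeVectorHopping_eq_zero _ _ q c hw t hwR

/-- **The plane stack sees no interlayer pattern** (zero cell energy). [cite: ArakiMoriya2003, §11.1 Theorem 11.2] -/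
theorem cellEnergy_planeStack_sublatticeVectorHoppingViews_eq_zero (ω : Fin (p + 1) → InfVolFermionState d)
    (h : ∀ j, (ω j).IsEven) (q : Fin (d + 1) → ℕ) (c : Site (d + 1)) {w : Site (d + 1)} (hw : w 0 ≠ 0) (t : ℝ)
    {R : ℝ} (hwR : w ∈ thicken ({0} : Finset (Site (d + 1))) R) :
    (planeStack p ω h).cellEnergy (sublatticeVectorHoppingViews q c w t) R = 0 := by
  rw [InfVolFermionState.cellEnergy]
  refine mul_eq_zero_of_right _ (Finset.sum_eq_zero fun n _ => ?_)
  rw [sublatticeVectorHoppingViews]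
  exact meanEnergy_shift_planeStack_sublatticeVectorHopping_eq_zero ω h _ q _ hw t hwR

/-- Layer coordinate of the stacking period. [cite: ArakiMoriya2003, §4.1] -/
theorem periodVec_stackPeriods_zero_apply_zero : periodVec (stackPeriods d p) 0 0 = (p : ℤ) + 1 := by
  rw [periodVec, Pi.single_eq_same, stackPeriods_zero]

/-- In-plane coordinates of the stacking period vanish. [cite: ArakiMoriya2003, §4.1] -/
theorem tail_periodVec_stackPeriods_zero : Fin.tail (periodVec (stackPeriods d p) 0) = 0 := by
  funext i
  rw [Fin.tail, periodVec, Pi.single_eq_of_ne (Fin.succ_ne_zero i), Pi.zero_apply]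

/-- **The plane stack of translation-invariant factors is periodic under the stacking superlattice** (the stacking
period relabels layers within their classes; in-plane periods translate the factors). [cite: ArakiMoriya2003, §4.1 Def. 4.5] -/
theorem isPeriodic_planeStack {ω : Fin (p + 1) → InfVolFermionState d} (hω : ∀ j, (ω j).IsTranslationInvariant)
    (h : ∀ j, (ω j).IsEven) : (planeStack p ω h).IsPeriodic (stackPeriods d p) := by
  intro i
  refine Fin.cases ?_ (fun i => ?_) i
  · rw [planeStack, layerProduct_shift]
    refine productState_congr _ (funext fun k => ?_)
    rw [tail_periodVec_stackPeriods_zero, shift_zero, periodVec_stackPeriods_zero_apply_zero, layerClass_add_period]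
  · rw [periodVec_stackPeriods_succ, planeStack, layerProduct_shift]
    refine productState_congr _ (funext fun k => ?_)
    rw [layerHom_apply, Fin.cons_zero, add_zero, Fin.tail_cons, hω]

/-- **The cell filling of the plane stack is the mean density of the factors**: `(p+1)⁻¹ Σ_j ρ(ω j)`.
[cite: ArakiMoriya2003, §11.1 Theorem 11.2] -/
theorem cellFilling_planeStack (ω : Fin (p + 1) → InfVolFermionState d) (h : ∀ j, (ω j).IsEven) :
    (planeStack p ω h).cellFilling (stackPeriods d p) = ((p : ℝ) + 1)⁻¹ * ∑ j, (ω j).density := by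
  rw [cellFilling_eq_density_cellAverage, InfVolFermionState.cellAverage, density_shiftAverage, card_cell_stackPeriods,
    Nat.cast_add, Nat.cast_one, sum_cell_eq_sum_layerCell]
  simp only [cellPos_layerCell, density_shift_planeStack_layerCoset]

/-- The plane stack of translation-invariant factors is a periodic state of cell filling the mean density — the
trial state of a DENSITY SPLIT `(ρ(ω j))_j`. [cite: ArakiMoriya2003, §11.1 Theorem 11.2] -/
theorem planeStack_mem_periodicStatesAt {ω : Fin (p + 1) → InfVolFermionState d}
    (hω : ∀ j, (ω j).IsTranslationInvariant) (h : ∀ j, (ω j).IsEven) :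
    planeStack p ω h ∈ periodicStatesAt (stackPeriods d p) (((p : ℝ) + 1)⁻¹ * ∑ j, (ω j).density) :=
  ⟨isPeriodic_planeStack hω h, cellFilling_planeStack ω h⟩

end InfVolFermionState

end Literature.MathematicalPhysics.QuantumLattice
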